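import Summits.HodgeConjecture.HodgeConjecture.Theorems.F0P3CotangentFormValueMap
import Summits.HodgeConjecture.HodgeConjecture.Theorems.F0P3GenIrreducibleOfUnitary
import Summits.HodgeConjecture.HodgeConjecture.Theorems.F0P3LieSpanClosureInvariant
import HarnessLib

/-!
# Crux `H413` — RUNG 1½ «ISOTYPY FROM A NULL CORE», brick B4b-ii: the classes of the `U(𝔤)`-span `S(Φ)` of a holomorphic cotangent form
# ARE the module `gen` generated by its coordinate classes in `P.archModuleCM`

Floor-0 programme P3 «U3-mult», seat F0P3-p02 (g3); crux item stmt-HodgeConjecture-24833 (`HCCMUnconditional.H413`); road doc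
`F0/P3/F0P3-p02/ROAD-F1a-inhouse.F0P3p02g3.md` (B1 ★ `F0P3GenIrreducibleOfUnitary`, B2 ★ `HarishChandraModuleIntertwiners`, B3 ★
`F0P3LieSpanClosureInvariant` / `F0P3HolFormClosedSubrep`, B4a `F0P3GenClosureKFinite`).  HC_CM is proved only modulo the printed citations until rung 0 closes.

Setting = F0P3-p01 (g3)'s B1′ ★ `F0P3CotangentFormValueMap`: the CM frame `(L, ι, H, T, hT)`, compact quotient, automorphic `μ`, discrete `P`,
`Φ ∈ holCotForms (cmArchSection …) (cmCompactFactor …)` with coordinate classes `v₀, v₁ ∈ P.archModuleCM ι T hT` (★ `exists_vectors`), the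
`L²`-Lie-stable span `S(Φ) = span {iterLieDeriv cmArchSection l Φⱼ}` (★ `F0P3CotangentFormL2Span.isL2LieStable_span`), and — T6 currency at
`(ρK, ρ𝔤) = (P.archRepKCM, P.archRepLieCM) ι T hT`, `μ = i` — the module `gen (P.archRepLieCM ι T hT) Complex.I (span {v₀, v₁})` (★ `F0P3bPNullGeneration`).

* `lieSpan_eq_span_iterLieDeriv` — B3's `𝔤`-span of `span {Φ₀, Φ₁}` IS `S(Φ)` (★ `lieSpan_le` both ways), so B3-CM's closed invariant subspace
  `C_Φ` is the closure of the classes of `S(Φ)`.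
* **`coe_mem_l2OfForms_of_mem_gen`** — every `x ∈ gen` has `L²`-class in `l2OfForms 𝒰 μ S(Φ)`: the vectors with class `[ψ]`, `ψ ∈ S(Φ)`, form a
  `𝔤`-stable subspace (★ `coe_archRepLieCM_eq_toLp_lieDeriv_of`: `ρ𝔤(Y)[ψ] = [Y♭ψ]`) containing `v₀, v₁`, and `gen` is the `𝔤`-stable hull of its core
  (`gen_le_of_lie_stable`, the `𝔤`-only form of ★ `gen_le_of_core_le`).
* (sequel file, B4b-iii) the converse `exists_mem_gen_of_mem_l2OfForms` — every class of `S(Φ)` is the class of an element of `gen` (word by word,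
  `[Y′ χ] = ρ𝔤(Y)[χ]` for the un-reindexed `Y`, ★ `reindex_symm_mem_uFormGroup_lie`; `gen` `𝔤`-stable by ★ `isGKSubmodule_gen`) — so that
  `l2OfForms 𝒰 μ S(Φ)` = the image of `gen` in `L²`, the input `hFC` of B4a ★ `mem_gen_of_mem_closure_of_finite`.

No definition, no sorry, no named fact; `--supports stmt-HodgeConjecture-24833 --as helper`.

References: [HarishChandra1953] §7, §9; [BorelWallach2000] 0 §2.4, II §4.1; [BorelJacquetCorvallis1979] §4.6.
-/

-- Mathlib idiom (as in ★ `GKModules` and every `(𝔤, K)` file of the tree): commutator bracket on `Module.End` / matrices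
attribute [local instance 100] LieRing.ofAssociativeRing

set_option autoImplicit false
-- the mandated namespace repeats `HodgeConjecture.HodgeConjecture`, as in every `Theorems/*.lean` of this sub-problem
set_option linter.dupNamespace false

noncomputable section

open scoped Matrix MatrixGroups ComplexConjugate ENNReal
open NumberField MeasureTheory MulAction

namespace Summit.HodgeConjecture.HodgeConjecture.Cruxes.H413.F0P3HolFormGenClasses

open Literature.NumberTheory.Automorphic Literature.NumberTheory.Automorphic.UnitaryGroup
open Literature.NumberTheory.Automorphic.UnitaryGroup.CotangentForms
open Literature.RepresentationTheory.KonnoKonno2007 Literature.RepresentationTheory.KonnoKonno2007.RealDualPair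
open Literature.RepresentationTheory.BorelWallach2000
open Literature.Geometry.ComplexHyperbolic.BallModel (U21 J)
open Literature.AlgebraicGeometry.ShimuraVarieties.BallForms (u21Group liePMat)
open Summit.HodgeConjecture.HodgeConjecture.Cruxes.H413.F0P2aL2cOrderedProducts
open Summit.HodgeConjecture.HodgeConjecture.Cruxes.H413.F0P2aL2bHolLieSpanPackage
open Summit.HodgeConjecture.HodgeConjecture.Cruxes.H413.F0P3CMFrameOrbit
open Summit.HodgeConjecture.HodgeConjecture.Cruxes.H413.F0P3CotangentFormL2Span
open Summit.HodgeConjecture.HodgeConjecture.Cruxes.H413.F0P3CotangentFormValueMap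
open Summit.HodgeConjecture.HodgeConjecture.Cruxes.H413.F0P2aArchOrthHol (lieSpan_le le_lieSpan)
open Summit.HodgeConjecture.HodgeConjecture.Cruxes.H413.F0P3bPPartOperators
open Summit.HodgeConjecture.HodgeConjecture.Cruxes.H413.F0P3bPNullGeneration
open Summit.HodgeConjecture.HodgeConjecture.Cruxes.H413.F0P3GenIrreducibleOfUnitary

variable {L : Type} [Field L] [NumberField L] [IsCMField L] (ι : L →+* ℂ) {H : Matrix (Fin 3) (Fin 3) L}
  (T : GL (Fin 3) ℂ) (hT : (T : Matrix (Fin 3) (Fin 3) ℂ)ᴴ * H.map ι * (T : Matrix (Fin 3) (Fin 3) ℂ) = J)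
  {μ : Measure (adelicGroupData (↥(maximalRealSubfield L)) L (IsCMField.complexConj L) 3 H).automorphicQuotient}
  [(adelicGroupData (↥(maximalRealSubfield L)) L (IsCMField.complexConj L) 3 H).IsAutomorphicMeasure μ]
  [CompactSpace (adelicGroupData (↥(maximalRealSubfield L)) L (IsCMField.complexConj L) 3 H).automorphicQuotient]
  (P : DiscreteAutomorphicRep (adelicGroupData (↥(maximalRealSubfield L)) L (IsCMField.complexConj L) 3 H) μ)
  {Φ : (adelicGroupData (↥(maximalRealSubfield L)) L (IsCMField.complexConj L) 3 H).Adelic → (Fin 2 → ℂ)}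

/-! ## §0 Generic: `gen` lies in every `𝔤`-stable subspace containing the core -/

omit [(adelicGroupData (↥(maximalRealSubfield L)) L (IsCMField.complexConj L) 3 H).IsAutomorphicMeasure μ]
  [CompactSpace (adelicGroupData (↥(maximalRealSubfield L)) L (IsCMField.complexConj L) 3 H).automorphicQuotient] in
/-- **`gen` is contained in every `𝔤`-stable subspace containing the core** (the raising operators are combinations of `ρ𝔤`; the `𝔤`-only form
of ★ `gen_le_of_core_le`). [folklore] -/
theorem gen_le_of_lie_stable {α β : Type} [Fintype α] [DecidableEq α] [Fintype β] [DecidableEq β] {V : Type} [AddCommGroup V] [Module ℂ V]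
    {ρ𝔤 : (uFormGroup α β).lie →ₗ⁅ℝ⁆ Module.End ℂ V} {c : ℂ} {E Q : Submodule ℂ V}
    (hQ : ∀ (X : (uFormGroup α β).lie), ∀ u ∈ Q, ρ𝔤 X u ∈ Q) (hEQ : E ≤ Q) : gen ρ𝔤 c E ≤ Q := by
  have h : ∀ n : ℕ, grade ρ𝔤 c E n ≤ Q := by
    intro n
    induction n with
    | zero => exact hEQ
    | succ n ih =>
      rw [grade_succ]
      refine iSup_le fun s => Submodule.map_le_iff_le_comap.mpr fun u hu => ?_
      rw [Submodule.mem_comap, pOp_apply]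
      exact Submodule.add_mem _ (hQ _ u (ih hu)) (Submodule.smul_mem _ _ (hQ _ u (ih hu)))
  exact iSup_le h

/-! ## §1 B3's `𝔤`-span of the coordinates is `S(Φ)` -/

omit [(adelicGroupData (↥(maximalRealSubfield L)) L (IsCMField.complexConj L) 3 H).IsAutomorphicMeasure μ]
  [CompactSpace (adelicGroupData (↥(maximalRealSubfield L)) L (IsCMField.complexConj L) 3 H).automorphicQuotient] in
/-- **The `𝔤`-span of `span {Φ₀, Φ₁}` (B3's `S_Φ`) is p01's `S(Φ)`** (the span of the `iterLieDeriv cmArchSection l Φⱼ`): `⊇` generator by generator,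
`⊆` because `S(Φ)` is Lie-stable and contains the coordinates (★ `lieSpan_le`). [cite: BorelJacquetCorvallis1979, §4.6] -/
theorem lieSpan_eq_span_iterLieDeriv
    (hΦ : Φ ∈ holCotForms (↥(maximalRealSubfield L)) L (IsCMField.complexConj L) 3 H (cmArchSection L ι H T hT)
      (cmCompactFactor L ι H T hT)) :
    Submodule.span ℂ {χ | ∃ (l : List u21Group.lie) (ψ : (adelicGroupData (↥(maximalRealSubfield L)) L (IsCMField.complexConj L) 3 H).Adelic → ℂ),
        ψ ∈ Submodule.span ℂ (Set.range fun j : Fin 2 => fun x => Φ x j) ∧ χ = iterLieDeriv (H := u21Group) (cmArchSection L ι H T hT) l ψ} =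
      Submodule.span ℂ (Set.range fun p : List u21Group.lie × Fin 2 =>
        iterLieDeriv (H := u21Group) (cmArchSection L ι H T hT) p.1 fun x => Φ x p.2) := by
  refine le_antisymm ?_ (Submodule.span_le.2 ?_)
  · refine lieSpan_le (cmArchSection L ι H T hT) (Submodule.span_le.2 ?_) fun X φ hφ => span_iterLieDeriv_hol_lieDeriv_mem hΦ X hφ
    rintro _ ⟨j, rfl⟩
    exact apply_mem_span_iterLieDeriv_hol (hT := hT) j
  · rintro _ ⟨⟨l, j⟩, rfl⟩
    exact Submodule.subset_span ⟨l, fun x => Φ x j, Submodule.subset_span ⟨j, rfl⟩, rfl⟩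

/-! ## §2 `gen` read in `L²` lies in the classes of `S(Φ)` -/

/-- **Every element of `gen` has `L²`-class in `l2OfForms 𝒰 μ S(Φ)`.**  The set of vectors of `P.archModuleCM` whose class is `[ψ]` for some `ψ ∈ S(Φ)` is a
`𝔤`-stable subspace (★ `coe_archRepLieCM_eq_toLp_lieDeriv_of`: `ρ𝔤(Y) [ψ] = [Y♭ ψ]`, `S(Φ)` Lie-stable) containing `v₀, v₁`, hence `gen`.
[cite: HarishChandra1953, §9] [cite: BorelWallach2000, 0 §2.4] -/
theorem coe_mem_l2OfForms_of_mem_gen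
    (hΦ : Φ ∈ holCotForms (↥(maximalRealSubfield L)) L (IsCMField.complexConj L) 3 H (cmArchSection L ι H T hT)
      (cmCompactFactor L ι H T hT)) (v : Fin 2 → P.archModuleCM ι T hT)
    (hv : ∀ j : Fin 2, (((v j : P.archModuleCM ι T hT) : P.space.toSubmodule) : (adelicGroupData (↥(maximalRealSubfield L)) L (IsCMField.complexConj L) 3 H).L2 μ) =
      (memLp_toQuotFun_apply ι T hT (μ := μ) hΦ j).toLp (toQuotFun (adelicGroupData (↥(maximalRealSubfield L)) L (IsCMField.complexConj L) 3 H) fun x => Φ x j))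
    {x : P.archModuleCM ι T hT} (hx : x ∈ gen (P.archRepLieCM ι T hT) Complex.I (Submodule.span ℂ (Set.range v))) :
    ((x : P.space.toSubmodule) : (adelicGroupData (↥(maximalRealSubfield L)) L (IsCMField.complexConj L) 3 H).L2 μ) ∈
      l2OfForms (adelicGroupData (↥(maximalRealSubfield L)) L (IsCMField.complexConj L) 3 H) μ
        (Submodule.span ℂ (Set.range fun p : List u21Group.lie × Fin 2 =>
          iterLieDeriv (H := u21Group) (cmArchSection L ι H T hT) p.1 fun x => Φ x p.2)) := by
  have hW := isL2LieStable_span ι T hT (μ := μ) hΦ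
  set S := Submodule.span ℂ (Set.range fun p : List u21Group.lie × Fin 2 =>
    iterLieDeriv (H := u21Group) (cmArchSection L ι H T hT) p.1 fun x => Φ x p.2) with hS_def
  -- classes of members of `S`
  have hinvQ : ∀ ψ (hψ : ψ ∈ S), invQuot _ (toQuotFun (adelicGroupData (↥(maximalRealSubfield L)) L (IsCMField.complexConj L) 3 H) ψ) = ψ :=
    fun ψ hψ => funext fun g => by rw [invQuot_apply, ← SpectrumJunction.apply_eq_toQuotFun (leftInvariant_of_mem ι T hT hW hψ) g]
  -- the subspace `Q` of vectors whose class is the class of a member of `S`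
  let Q : Submodule ℂ (P.archModuleCM ι T hT) :=
    { carrier := {x | ∃ (ψ : _) (hψ : ψ ∈ S), ((x : P.space.toSubmodule) : (adelicGroupData (↥(maximalRealSubfield L)) L (IsCMField.complexConj L) 3 H).L2 μ) =
        (memLp_toQuotFun_of_mem ι T hT hW hψ).toLp _}
      add_mem' := by
        rintro x y ⟨ψ, hψ, hxψ⟩ ⟨ψ', hψ', hyψ'⟩
        refine ⟨ψ + ψ', S.add_mem hψ hψ', ?_⟩
        rw [Submodule.coe_add, Submodule.coe_add, hxψ, hyψ', ← MemLp.toLp_add]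
        exact MemLp.toLp_congr _ _ (Filter.EventuallyEq.of_eq rfl)
      zero_mem' := by
        refine ⟨0, S.zero_mem, ?_⟩
        rw [Submodule.coe_zero, Submodule.coe_zero]
        have e : (memLp_toQuotFun_of_mem ι T hT hW S.zero_mem).toLp _ =
            (MemLp.zero : MemLp (0 : (adelicGroupData (↥(maximalRealSubfield L)) L (IsCMField.complexConj L) 3 H).automorphicQuotient → ℂ) 2 μ).toLp 0 :=
          MemLp.toLp_congr _ _ (Filter.EventuallyEq.of_eq rfl)
        rw [e, MemLp.toLp_zero]
      smul_mem' := by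
        rintro a x ⟨ψ, hψ, hxψ⟩
        refine ⟨a • ψ, S.smul_mem a hψ, ?_⟩
        rw [Submodule.coe_smul, Submodule.coe_smul, hxψ, ← MemLp.toLp_const_smul]
        exact MemLp.toLp_congr _ _ (Filter.EventuallyEq.of_eq rfl) }
  have hQmem : ∀ {x : P.archModuleCM ι T hT}, x ∈ Q ↔ ∃ (ψ : _) (hψ : ψ ∈ S),
      ((x : P.space.toSubmodule) : (adelicGroupData (↥(maximalRealSubfield L)) L (IsCMField.complexConj L) 3 H).L2 μ) =
        (memLp_toQuotFun_of_mem ι T hT hW hψ).toLp _ := Iff.rfl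
  -- `Q` is `𝔤`-stable
  have hQlie : ∀ (Y : (uFormGroup (Fin 2) (Fin 1)).lie), ∀ x ∈ Q, P.archRepLieCM ι T hT Y x ∈ Q := by
    intro Y x hx
    obtain ⟨ψ, hψ, hxψ⟩ := hQmem.1 hx
    obtain ⟨Y', hY'⟩ := exists_reindexed Y
    refine hQmem.2 ⟨lieDeriv (H := u21Group) (cmArchSection L ι H T hT) Y' ψ, hW.lie_mem Y' ψ hψ, ?_⟩
    exact coe_archRepLieCM_eq_toLp_lieDeriv_of ι T hT hW P (Ψ := fun x _ => ψ x) (fun _ => hψ) (j := 0) hxψ Y Y' hY'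
  -- `Q` contains the core
  have hEQ : Submodule.span ℂ (Set.range v) ≤ Q := by
    refine Submodule.span_le.2 ?_
    rintro _ ⟨j, rfl⟩
    exact hQmem.2 ⟨fun x => Φ x j, apply_mem_span_iterLieDeriv_hol (hT := hT) j, hv j⟩
  -- hence `gen ≤ Q`
  obtain ⟨ψ, hψ, hxψ⟩ := hQmem.1 (gen_le_of_lie_stable hQlie hEQ hx)
  exact ⟨_, memLp_toQuotFun_of_mem ι T hT hW hψ, hxψ.symm, by rw [hinvQ ψ hψ]; exact hψ⟩


/-! ## §3 Conversely: every class of `S(Φ)` is the class of an element of `gen` -/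

/-- One Lie derivative: if the class of `x ∈ gen` is `[χ]`, `χ ∈ S(Φ)`, then for every `Y′ ∈ 𝔲(2,1)` the class of `ρ𝔤(Y) x ∈ gen` (`Y` the un-reindexed
`Y′`, ★ `reindex_symm_mem_uFormGroup_lie`) is `[Y′ χ]` (★ `coe_archRepLieCM_eq_toLp_lieDeriv_of`, ★ `isGKSubmodule_gen`). [cite: HarishChandra1953, §9] -/
theorem exists_mem_gen_coe_eq_toLp_lieDeriv
    (hΦ : Φ ∈ holCotForms (↥(maximalRealSubfield L)) L (IsCMField.complexConj L) 3 H (cmArchSection L ι H T hT)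
      (cmCompactFactor L ι H T hT)) (v : Fin 2 → P.archModuleCM ι T hT)
    (hEn : ∀ e ∈ Submodule.span ℂ (Set.range v), ∀ s : (Fin 2 × Fin 1) × Fin 2,
      pOp (P.archRepLieCM ι T hT) Complex.I (upqPBasis s) e = 0)
    (hEk : ∀ W ∈ (uFormGroup (Fin 2) (Fin 1)).kInLie, ∀ e ∈ Submodule.span ℂ (Set.range v), P.archRepLieCM ι T hT W e ∈ Submodule.span ℂ (Set.range v))
    (hEK : ∀ (k : (uFormGroup (Fin 2) (Fin 1)).maximalCompact), ∀ e ∈ Submodule.span ℂ (Set.range v),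
      P.archRepKCM ι T hT k e ∈ Submodule.span ℂ (Set.range v))
    {χ : (adelicGroupData (↥(maximalRealSubfield L)) L (IsCMField.complexConj L) 3 H).Adelic → ℂ}
    (hχ : χ ∈ Submodule.span ℂ (Set.range fun p : List u21Group.lie × Fin 2 =>
      iterLieDeriv (H := u21Group) (cmArchSection L ι H T hT) p.1 fun x => Φ x p.2))
    {x : P.archModuleCM ι T hT} (hx : x ∈ gen (P.archRepLieCM ι T hT) Complex.I (Submodule.span ℂ (Set.range v)))
    (hm : MemLp (toQuotFun (adelicGroupData (↥(maximalRealSubfield L)) L (IsCMField.complexConj L) 3 H) χ) 2 μ)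
    (hxe : ((x : P.space.toSubmodule) : (adelicGroupData (↥(maximalRealSubfield L)) L (IsCMField.complexConj L) 3 H).L2 μ) = hm.toLp _)
    (Y' : u21Group.lie) :
    ∃ x' ∈ gen (P.archRepLieCM ι T hT) Complex.I (Submodule.span ℂ (Set.range v)),
      ∃ hm' : MemLp (toQuotFun (adelicGroupData (↥(maximalRealSubfield L)) L (IsCMField.complexConj L) 3 H)
        (lieDeriv (H := u21Group) (cmArchSection L ι H T hT) Y' χ)) 2 μ,
        ((x' : P.space.toSubmodule) : (adelicGroupData (↥(maximalRealSubfield L)) L (IsCMField.complexConj L) 3 H).L2 μ) = hm'.toLp _ := by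
  have hW := isL2LieStable_span ι T hT (μ := μ) hΦ
  have hgen : IsGKSubmodule (P.archRepKCM ι T hT) (P.archRepLieCM ι T hT)
      (gen (P.archRepLieCM ι T hT) Complex.I (Submodule.span ℂ (Set.range v))) :=
    isGKSubmodule_gen (P.isGKModule_archModuleCM ι T hT).ad_compat hEn hEk hEK
  let Y : (uFormGroup (Fin 2) (Fin 1)).lie := ⟨_, reindex_symm_mem_uFormGroup_lie Y'.2⟩
  have hYdef : (Y : Matrix (Fin 2 ⊕ Fin 1) (Fin 2 ⊕ Fin 1) ℂ) =
      Matrix.reindex (finSumFinEquiv : Fin 2 ⊕ Fin 1 ≃ Fin 3).symm (finSumFinEquiv : Fin 2 ⊕ Fin 1 ≃ Fin 3).symm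
        (Y' : Matrix (Fin 3) (Fin 3) ℂ) := rfl
  have hY : (Y' : Matrix (Fin 3) (Fin 3) ℂ) = Matrix.reindex (finSumFinEquiv : Fin 2 ⊕ Fin 1 ≃ Fin 3) (finSumFinEquiv : Fin 2 ⊕ Fin 1 ≃ Fin 3)
      (Y : Matrix (Fin 2 ⊕ Fin 1) (Fin 2 ⊕ Fin 1) ℂ) := by
    rw [hYdef]
    ext a b
    simp [Matrix.reindex_apply, Matrix.submatrix_apply]
  refine ⟨P.archRepLieCM ι T hT Y x, hgen.2 Y x hx, memLp_toQuotFun_of_mem ι T hT hW (hW.lie_mem Y' χ hχ), ?_⟩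
  have hxe' : ((x : P.space.toSubmodule) : (adelicGroupData (↥(maximalRealSubfield L)) L (IsCMField.complexConj L) 3 H).L2 μ) =
      (memLp_toQuotFun_of_mem ι T hT hW hχ).toLp _ := hxe
  exact coe_archRepLieCM_eq_toLp_lieDeriv_of ι T hT hW P (Ψ := fun z _ => χ z) (fun _ => hχ) (j := 0) hxe' Y Y' hY

/-- **Every class of `S(Φ)` is the `L²`-class of an element of `gen`** — provided `span {v₀, v₁}` is a null core for `μ = i` (`hEn`, `hEk`, `hEK`: the
conjuncts (hN), (h𝔨), (hK) of ★ `valueMap_hol`).  The functions `ψ` admitting such an element form a subspace containing every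
`iterLieDeriv l Φⱼ` (word by word, `exists_mem_gen_coe_eq_toLp_lieDeriv`), hence `S(Φ)`. [cite: HarishChandra1953, §9] [cite: BorelWallach2000, II §4.1] -/
theorem exists_mem_gen_of_mem_l2OfForms
    (hΦ : Φ ∈ holCotForms (↥(maximalRealSubfield L)) L (IsCMField.complexConj L) 3 H (cmArchSection L ι H T hT)
      (cmCompactFactor L ι H T hT)) (v : Fin 2 → P.archModuleCM ι T hT)
    (hv : ∀ j : Fin 2, (((v j : P.archModuleCM ι T hT) : P.space.toSubmodule) : (adelicGroupData (↥(maximalRealSubfield L)) L (IsCMField.complexConj L) 3 H).L2 μ) =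
      (memLp_toQuotFun_apply ι T hT (μ := μ) hΦ j).toLp (toQuotFun (adelicGroupData (↥(maximalRealSubfield L)) L (IsCMField.complexConj L) 3 H) fun x => Φ x j))
    (hEn : ∀ e ∈ Submodule.span ℂ (Set.range v), ∀ s : (Fin 2 × Fin 1) × Fin 2,
      pOp (P.archRepLieCM ι T hT) Complex.I (upqPBasis s) e = 0)
    (hEk : ∀ W ∈ (uFormGroup (Fin 2) (Fin 1)).kInLie, ∀ e ∈ Submodule.span ℂ (Set.range v), P.archRepLieCM ι T hT W e ∈ Submodule.span ℂ (Set.range v))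
    (hEK : ∀ (k : (uFormGroup (Fin 2) (Fin 1)).maximalCompact), ∀ e ∈ Submodule.span ℂ (Set.range v),
      P.archRepKCM ι T hT k e ∈ Submodule.span ℂ (Set.range v))
    {y : (adelicGroupData (↥(maximalRealSubfield L)) L (IsCMField.complexConj L) 3 H).L2 μ}
    (hy : y ∈ l2OfForms (adelicGroupData (↥(maximalRealSubfield L)) L (IsCMField.complexConj L) 3 H) μ
        (Submodule.span ℂ (Set.range fun p : List u21Group.lie × Fin 2 =>
          iterLieDeriv (H := u21Group) (cmArchSection L ι H T hT) p.1 fun x => Φ x p.2))) :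
    ∃ x ∈ gen (P.archRepLieCM ι T hT) Complex.I (Submodule.span ℂ (Set.range v)),
      ((x : P.space.toSubmodule) : (adelicGroupData (↥(maximalRealSubfield L)) L (IsCMField.complexConj L) 3 H).L2 μ) = y := by
  have hW := isL2LieStable_span ι T hT (μ := μ) hΦ
  -- the subspace of functions admitting an element of `gen` with the same class
  let Q : Submodule ℂ ((adelicGroupData (↥(maximalRealSubfield L)) L (IsCMField.complexConj L) 3 H).Adelic → ℂ) :=
    { carrier := {ψ | ∃ x ∈ gen (P.archRepLieCM ι T hT) Complex.I (Submodule.span ℂ (Set.range v)),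
        ∃ hm : MemLp (toQuotFun (adelicGroupData (↥(maximalRealSubfield L)) L (IsCMField.complexConj L) 3 H) ψ) 2 μ,
          ((x : P.space.toSubmodule) : (adelicGroupData (↥(maximalRealSubfield L)) L (IsCMField.complexConj L) 3 H).L2 μ) = hm.toLp _}
      add_mem' := by
        rintro ψ ψ' ⟨x, hx, hm, hxe⟩ ⟨x', hx', hm', hxe'⟩
        refine ⟨x + x', Submodule.add_mem _ hx hx', hm.add hm', ?_⟩
        rw [Submodule.coe_add, Submodule.coe_add, hxe, hxe', ← MemLp.toLp_add]
        exact MemLp.toLp_congr _ _ (Filter.EventuallyEq.of_eq (SpectrumJunction.toQuotFun_add _ _).symm)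
      zero_mem' := by
        refine ⟨0, Submodule.zero_mem _, MemLp.zero, ?_⟩
        rw [Submodule.coe_zero, Submodule.coe_zero]
        exact (MemLp.toLp_zero _).symm
      smul_mem' := by
        rintro a ψ ⟨x, hx, hm, hxe⟩
        refine ⟨a • x, Submodule.smul_mem _ a hx, hm.const_smul a, ?_⟩
        rw [Submodule.coe_smul, Submodule.coe_smul, hxe, ← MemLp.toLp_const_smul]
        exact MemLp.toLp_congr _ _ (Filter.EventuallyEq.of_eq (SpectrumJunction.toQuotFun_smul _ _).symm) }
  have hQmem : ∀ {ψ}, ψ ∈ Q ↔ ∃ x ∈ gen (P.archRepLieCM ι T hT) Complex.I (Submodule.span ℂ (Set.range v)),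
      ∃ hm : MemLp (toQuotFun (adelicGroupData (↥(maximalRealSubfield L)) L (IsCMField.complexConj L) 3 H) ψ) 2 μ,
        ((x : P.space.toSubmodule) : (adelicGroupData (↥(maximalRealSubfield L)) L (IsCMField.complexConj L) 3 H).L2 μ) = hm.toLp _ := Iff.rfl
  -- the generators, word by word
  have hword : ∀ (l : List u21Group.lie) (j : Fin 2), (iterLieDeriv (H := u21Group) (cmArchSection L ι H T hT) l fun x => Φ x j) ∈ Q := by
    intro l j
    induction l with
    | nil => exact hQmem.2 ⟨v j, le_gen _ _ (Submodule.subset_span ⟨j, rfl⟩), memLp_toQuotFun_apply ι T hT (μ := μ) hΦ j, hv j⟩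
    | cons Y' l ih =>
      obtain ⟨x, hx, hm, hxe⟩ := hQmem.1 ih
      obtain ⟨x', hx', hm', hxe'⟩ := exists_mem_gen_coe_eq_toLp_lieDeriv ι T hT P hΦ v hEn hEk hEK
        (Submodule.subset_span ⟨(l, j), rfl⟩) hx hm hxe Y'
      exact hQmem.2 ⟨x', hx', hm', hxe'⟩
  have hSQ : Submodule.span ℂ (Set.range fun p : List u21Group.lie × Fin 2 =>
      iterLieDeriv (H := u21Group) (cmArchSection L ι H T hT) p.1 fun x => Φ x p.2) ≤ Q := by
    refine Submodule.span_le.2 ?_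
    rintro _ ⟨⟨l, j⟩, rfl⟩
    exact hword l j
  obtain ⟨f, hf, rfl, hfS⟩ := hy
  obtain ⟨x, hx, hm, hxe⟩ := hQmem.1 (hSQ hfS)
  have hinvQ : invQuot _ (toQuotFun (adelicGroupData (↥(maximalRealSubfield L)) L (IsCMField.complexConj L) 3 H) (invQuot _ f)) = invQuot _ f :=
    funext fun g => by rw [invQuot_apply, ← SpectrumJunction.apply_eq_toQuotFun (leftInvariant_of_mem ι T hT hW hfS) g]
  exact ⟨x, hx, hxe.trans (MemLp.toLp_congr _ _ (Filter.EventuallyEq.of_eq (invQuot_injective _ hinvQ)))⟩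

/-- **`l2OfForms 𝒰 μ S(Φ)` is exactly the image of `gen` in `L²`** (`coe_mem_l2OfForms_of_mem_gen` and `exists_mem_gen_of_mem_l2OfForms`): the
input `hFC` of B4a ★ `F0P3GenClosureKFinite.mem_gen_of_mem_closure_of_finite` for B3-CM's closed invariant subspace `C_Φ`.
[cite: HarishChandra1953, §9] [cite: BorelWallach2000, II §4.1] -/
theorem l2OfForms_eq_map_gen
    (hΦ : Φ ∈ holCotForms (↥(maximalRealSubfield L)) L (IsCMField.complexConj L) 3 H (cmArchSection L ι H T hT)
      (cmCompactFactor L ι H T hT)) (v : Fin 2 → P.archModuleCM ι T hT)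
    (hv : ∀ j : Fin 2, (((v j : P.archModuleCM ι T hT) : P.space.toSubmodule) : (adelicGroupData (↥(maximalRealSubfield L)) L (IsCMField.complexConj L) 3 H).L2 μ) =
      (memLp_toQuotFun_apply ι T hT (μ := μ) hΦ j).toLp (toQuotFun (adelicGroupData (↥(maximalRealSubfield L)) L (IsCMField.complexConj L) 3 H) fun x => Φ x j))
    (hEn : ∀ e ∈ Submodule.span ℂ (Set.range v), ∀ s : (Fin 2 × Fin 1) × Fin 2,
      pOp (P.archRepLieCM ι T hT) Complex.I (upqPBasis s) e = 0)
    (hEk : ∀ W ∈ (uFormGroup (Fin 2) (Fin 1)).kInLie, ∀ e ∈ Submodule.span ℂ (Set.range v), P.archRepLieCM ι T hT W e ∈ Submodule.span ℂ (Set.range v))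
    (hEK : ∀ (k : (uFormGroup (Fin 2) (Fin 1)).maximalCompact), ∀ e ∈ Submodule.span ℂ (Set.range v),
      P.archRepKCM ι T hT k e ∈ Submodule.span ℂ (Set.range v)) :
    l2OfForms (adelicGroupData (↥(maximalRealSubfield L)) L (IsCMField.complexConj L) 3 H) μ
        (Submodule.span ℂ (Set.range fun p : List u21Group.lie × Fin 2 =>
          iterLieDeriv (H := u21Group) (cmArchSection L ι H T hT) p.1 fun x => Φ x p.2)) =
      (gen (P.archRepLieCM ι T hT) Complex.I (Submodule.span ℂ (Set.range v))).map
        (P.space.toSubmodule.subtype ∘ₗ (P.archModuleCM ι T hT).subtype) := by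
  ext y
  constructor
  · intro hy
    obtain ⟨x, hx, rfl⟩ := exists_mem_gen_of_mem_l2OfForms ι T hT P hΦ v hv hEn hEk hEK hy
    exact ⟨x, hx, rfl⟩
  · rintro ⟨x, hx, rfl⟩
    exact coe_mem_l2OfForms_of_mem_gen ι T hT P hΦ v hv hx

end Summit.HodgeConjecture.HodgeConjecture.Cruxes.H413.F0P3HolFormGenClasses

end
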